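import Literature.AlgebraicGeometry.Motives.HodgeGroupCovariantHodgeTensorsPoints
import Literature.AlgebraicGeometry.Motives.HodgeStructureLefschetzGroupPowersInvariantsHodgeClasses
import HarnessLib

/-!
# WEIL'S EMBEDDING `H^{⊗m} ↪ ⋀^m(H^{⊕m})` and «the Hodge group is the largest subgroup fixing all the Hodge classes on
# `A` AND ITS POWERS»: on `ℂ`-points, `γ ∈ Hg(H)(ℂ)` iff `γ ∈ Aut(Q_ℂ)` and the diagonal `⋀(Δγ)` fixes the complexification
# of every Hodge class of every `⋀^k(H^{⊕r})` — Milne's definition of `Hg′(A)` agrees with Deligne's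

[topic AlgebraicGeometry/Motives]

Layer `Literature/AlgebraicGeometry/Motives`, lane `lit-hodgefound` (Track 2 foundations library; seat `lit-hodgefound-p02`,
gen 39, row g39-#2). THEOREMS ONLY: no definition, no named fact (D-0026 net debt `0`), no instance, no notation. Sequel of
g39-#1 `Motives/HodgeGroupCovariantHodgeTensorsPoints` (for every field `K ⊇ ℚ`: `γ ∈ Hg(H)(K)` iff `γ ∈ Aut(Q_K)` and `γ^{⊗m}`
fixes `ι_⊗ Hdg(H^{⊗m})` for all `m`). Here the covariant tensor powers are traded for EXTERIOR POWERS OF POWERS through A. Weil's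
embedding `v₁ ⊗ ⋯ ⊗ v_m ↦ in₁(v₁) ∧ ⋯ ∧ in_m(v_m)`, `V^{⊗m} ↪ ⋀^m(V^{⊕m})` — on the tree's carriers the composite of morphisms of
Hodge structures `⊗_i in_i : H^{⊗m} → (H^{⊕m})^{⊗m}` (`Hom.tensorPowerMapFamily` of the `Hom.piSingle`) and the wedge projection
`(H^{⊕m})^{⊗m} → ⋀^m(H^{⊕m})` (`Hom.tensorToWedge`), written out in every statement (no definition is introduced) — so that the
tree's point-wise Hodge group `Hg(H)(ℂ)` (the fixing group of ALL Hodge tensors `T^{a,b}`, GGK (I.B.1)) coincides with the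
group cut out, among the isometries of `Q_ℂ`, by the Hodge classes `H(A^r) = ⊕_k Hdg(⋀^k(H^{⊕r}))` of the POWERS under the
DIAGONAL action `⋀(Δγ)` — the reading of J. S. Milne's `Hg′(A) = Ker(Hg(A) → 𝔾_m)`, «the largest algebraic subgroup of
`GL(V_B(A)) × 𝔾_m` fixing all the Hodge classes on `A` and its powers», used by p34's Milne-§4 files
(`Motives/HodgeStructureLefschetzGroupPowersInvariantsHodgeClasses`: `Θ = toComplexAlg`, `Δ = piDiagEmbedding`). This is the
step «(a) ⟹ `Hg′(A) = S(A)`» those files record as NOT there; the sequel row draws Prop. 4.8 (a) ⟹ (c).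

## The sources, verbatim

* J. S. Milne, *Lefschetz classes on abelian varieties*, Duke Math. J. **96** (1999) [Milne1999LefschetzClasses] §4 p. 660 (held
  `paper:doi-10-1215-s0012-7094-99-09620-5` p0022, as quoted in p34's g19-#1/g26-#2): «The Hodge group `Hg(A)` of `A` is defined to
  be the largest algebraic subgroup of `GL(V_B(A)) × 𝔾_m` fixing all the Hodge classes on `A` and its powers. It has the property
  that `H^{2*}(A^r)(*)^{Hg(A)} = H(A^r)` for all `r` (Deligne 1982, proof of Proposition 3.4). […] Projection onto `𝔾_m` defines a
  canonical character of `Hg(A)`, and we let `Hg′(A)` denote its kernel.»; §3 p. 653: «From the canonical isomorphisms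
  `H¹(A) = V(A)^∨`, `H¹(A^r) ≅ rH¹(A)`, `H^*(A^r) ≅ ⋀ H¹(A^r)`, we obtain an action of `S(A)` on `H^*(A^r)` for all `r`.»; Prop. 4.8
  proof: «The groups `Hg(A)` and `L(A)` are the largest algebraic subgroups of `GL(H¹(A)) × 𝔾_m` fixing respectively the Hodge
  classes and the Lefschetz classes on the powers of `A`».
* A. Weil, *Abelian varieties and the Hodge ring*, Œuvres III [1977c] (1979) 421–429 [Weil1977HodgeRing] — the embedding of the
  tensor invariants into the cohomology of a power that bears his name (Gordon's survey [Gordon1999HodgeAVSurvey] §7 and Milne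
  loc. cit. footnote 6: «Similar classes have been called extraordinary (Weil 1977, p424)»).
* M. Green, P. Griffiths, M. Kerr, *Mumford–Tate Groups and Domains* (2012) [GreenGriffithsKerr2012] §I.B: (I.B.1) «`M_φ` is the
  subgroup of `G` fixing `Hg_φ^{•,•}`», p. 35 «`M_φ ⊂ G = Aut(V, Q)`», (I.B.3) and p. 40 «hence to arbitrary representations of `M`,
  which are subquotients of these».
* B. Moonen, *Notes on Mumford–Tate groups* (1999) [Moonen1999MTNotes] (1.13): the Hodge group of `V^{⊕n}` is `Hg(V)` acting
  diagonally (the tree's `hodgeGroupBaseChange_pi_const_eq`).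

## The mechanism

§1 is linear algebra over a commutative ring `R`: for linear maps `j_i : M → N` (`i < m`) the multilinear map
`(w_i) ↦ j₁(w₁) ∧ ⋯ ∧ j_m(w_m)` induces `Φ_j : M^{⊗m} → ⋀^m N` (`PiTensorProduct.lift` of `ιMulti ∘ (j_i)`, written out); if the `j_i`
have retractions `q_i` with `q_i j_k = 0` (`i ≠ k`), then `(⊗_i q_i) ∘ (full antisymmetrisation) ∘ Φ_j = id` (in the alternating sum
`Σ_σ sgn σ ⊗_i q_i j_{σ i} w_{σ i}` only `σ = 1` survives), so `Φ_j` is INJECTIVE; and `Φ_j` intertwines `g^{⊗m}` with `⋀^m G` whenever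
`G j_i = j_i g`. §2: for `j_i = in_i : V → V^{⊕m}` this `Φ` IS the linear map of the composite morphism of Hodge structures
`⋀-projection ∘ (⊗_i in_i) : H^{⊗m} → ⋀^m(H^{⊕m})` (Weil's embedding), so it carries `Hdgᵖ(H^{⊗m})` into `Hdgᵖ(⋀^m(H^{⊕m}))`
(`Hom.map_hodgeClasses_le`). §3: over `ℂ`, with `j_i = (in_i)_ℂ`, `Φ_ℂ(ι_⊗ y)` has complexification `Θ(Φ y)` and
`⋀^m(Δγ) ∘ Φ_ℂ = Φ_ℂ ∘ γ^{⊗m}` (`Δγ ∘ (in_i)_ℂ = (in_i)_ℂ ∘ γ`, the tree's `piBlockDiag_comp_single_baseChange`); hence «`⋀(Δγ)`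
fixes `Θ x` for every Hodge class `x` of `⋀^m(H^{⊕m})`» forces «`γ^{⊗m}` fixes `ι_⊗ y` for every Hodge class `y` of `H^{⊗m}`», and
g39-#1 concludes `γ ∈ Hg(H)(ℂ)` for an isometry `γ`. The converse is the tree's `Hg(H^{⊕ι})(ℂ) = Δ Hg(H)(ℂ)` with (I.B.1) for `⋀^k`
(p34's `mem_hodgeClasses_exteriorPower_pi_iff_forall_piDiagEmbedding_map_toComplexAlg_eq`).

## What is PROVED

* §1 (`R` a commutative ring; `j : Fin m → (M →ₗ N)`): `lift_ιMulti_compLinearMap_tprod` (`Φ_j(⊗w) = ∧_i j_i w_i`),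
  `map_toTensorPower_lift_ιMulti_compLinearMap_tprod` (the retraction formula), **`lift_ιMulti_compLinearMap_injective`**,
  `exteriorPower_map_lift_ιMulti_compLinearMap` (equivariance).
* §2 (Hodge, `H₀ : HodgeStructure V n`): `weilHom_toLinearMap_tprod`, `weilHom_toLinearMap_eq` (the morphism
  `(Hom.tensorToWedge (pi H₀) m).comp (Hom.tensorPowerMapFamily (Hom.piSingle _))` has linear map `Φ_{in}`),
  **`lift_ιMulti_single_mem_hodgeClasses`** (`y ∈ Hdgᵖ(H₀^{⊗m}) ⟹ Φ y ∈ Hdgᵖ(⋀^m(H₀^{⊕m}))`), `lift_ιMulti_single_injective`.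
* §3 (`K`- and `ℂ`-points): `exteriorPower_map_piDiagEmbedding_lift_ιMulti_single_baseChange` (`⋀^m(Δγ) Φ_K = Φ_K γ^{⊗m}`, every field
  `K ⊇ ℚ`), `lift_ιMulti_single_baseChange_injective`, `coe_lift_ιMulti_single_baseChange_piTensorToBaseChange` (`Φ_ℂ ∘ ι_⊗ = Θ ∘ Φ` in
  `⋀_ℂ`), **`tensorPowerCongr_piTensorToBaseChange_eq_of_forall_piDiagEmbedding_map_toComplexAlg_eq`**
  (the transfer: diagonal invariance of the Hodge classes of `⋀^m(H₀^{⊕m})` ⟹ invariance of `ι_⊗ Hdg(H₀^{⊗m})`),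
  **`Polarization.mem_hodgeGroupBaseChange_complex_of_forall_piDiagEmbedding_map_toComplexAlg_eq`** (an isometry of `Q_ℂ` fixing,
  diagonally, the complexified Hodge classes of all `⋀^m(H₀^{⊕m})`, `m ≥ 1`, lies in `Hg(H₀)(ℂ)`),
  **`Polarization.mem_hodgeGroupBaseChange_complex_iff_forall_piDiagEmbedding_map_toComplexAlg_eq`** (MILNE = DELIGNE on `ℂ`-points:
  `γ ∈ Hg(H₀)(ℂ) ⟺ γ ∈ Aut(Q_ℂ) ∧ ∀ r ≥ 1, k, p (2p = kn), ∀ x ∈ Hdgᵖ(⋀^k(H₀^{⊕r})), ⋀(Δγ) Θx = Θx`), and the same with the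
  powers indexed by arbitrary finite non-empty types (`…_iff_forall_fintype`).

NOT here: Prop. 4.8 (a) ⟹ (c) itself and the SCMpHS consequences (the sequel row g39-#3); `K`-points other than `ℂ` for the
final statements (the transfer lemmas of §3 are over any `K ⊇ ℚ`, the Hodge-class dictionary of p34 is over `ℂ`).

## References

* [Milne1999LefschetzClasses] J. S. Milne, *Lefschetz classes on abelian varieties*, Duke Math. J. 96 (1999) 639–675: §3 p. 653,
  §4 p. 660, Prop. 4.8.
* [Weil1977HodgeRing] A. Weil, *Abelian varieties and the Hodge ring*, Œuvres Scientifiques III, [1977c], 421–429.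
* [Gordon1999HodgeAVSurvey] B. B. Gordon, *A survey of the Hodge conjecture for abelian varieties* (1999), §7.
* [GreenGriffithsKerr2012] M. Green, P. Griffiths, M. Kerr, *Mumford–Tate Groups and Domains*, PUP 2012, §I.B (I.B.1), (I.B.3), p. 40.
* [Moonen1999MTNotes] B. Moonen, *Notes on Mumford–Tate groups* (1999), (1.8), (1.13).
* [Greub1978Multilinear] W. Greub, *Multilinear Algebra*, 2nd ed. (1978), §5.3–§5.4 (the projection `⊗^p E → ∧^p E`).
-/

noncomputable section

open scoped TensorProduct PiTensorProduct

namespace Literature.AlgebraicGeometry.Motives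

namespace HodgeStructure

open ExteriorLefschetz

/-! ## §1 Weil's multilinear algebra: `Φ_j(⊗ w) = j₁w₁ ∧ ⋯ ∧ j_m w_m`, a retraction, injectivity, equivariance -/

section WeilLinearAlgebra

universe uR uM uN

variable {R : Type uR} [CommRing R] {M : Type uM} [AddCommGroup M] [Module R M] {N : Type uN} [AddCommGroup N] [Module R N]
  {m : ℕ} (j : Fin m → (M →ₗ[R] N))

/-- `Φ_j(w₁ ⊗ ⋯ ⊗ w_m) = j₁(w₁) ∧ ⋯ ∧ j_m(w_m)` for the map `Φ_j : M^{⊗m} → ⋀^m N` induced by the multilinear map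
`(w_i) ↦ ∧_i j_i(w_i)`. [cite: Greub1978Multilinear, §5.3–§5.4] -/
theorem lift_ιMulti_compLinearMap_tprod (w : Fin m → M) :
    PiTensorProduct.lift ((exteriorPower.ιMulti R m (M := N)).toMultilinearMap.compLinearMap j) (PiTensorProduct.tprod R w) =
      exteriorPower.ιMulti R m (fun i => j i (w i)) := by
  rw [PiTensorProduct.lift.tprod, MultilinearMap.compLinearMap_apply]
  rfl

/-- **The retraction formula**: if `q_i j_i = id` and `q_i j_k = 0` for `i ≠ k`, then
`(⊗_i q_i)(Σ_σ sgn σ · ⊗_i j_{σ i} w_{σ i}) = ⊗_i w_i` — in the full antisymmetrisation of `j₁w₁ ∧ ⋯ ∧ j_m w_m` (Mathlib's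
`exteriorPower.toTensorPower`) only the identity permutation survives the projections. [cite: Greub1978Multilinear, §5.3–§5.4] -/
theorem map_toTensorPower_lift_ιMulti_compLinearMap_tprod (q : Fin m → (N →ₗ[R] M)) (hqj : ∀ i x, q i (j i x) = x)
    (hqj' : ∀ i k, i ≠ k → ∀ x, q i (j k x) = 0) (w : Fin m → M) :
    PiTensorProduct.map q (exteriorPower.toTensorPower R N m
      (PiTensorProduct.lift ((exteriorPower.ιMulti R m (M := N)).toMultilinearMap.compLinearMap j) (PiTensorProduct.tprod R w))) =
      PiTensorProduct.tprod R w := by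
  rw [lift_ιMulti_compLinearMap_tprod, exteriorPower.toTensorPower_apply_ιMulti, map_sum,
    Finset.sum_eq_single (1 : Equiv.Perm (Fin m))]
  · rw [Equiv.Perm.sign_one, one_smul, PiTensorProduct.map_tprod]
    exact congrArg _ (funext fun i => by rw [Equiv.Perm.coe_one, id_eq, hqj])
  · intro σ _ hσ
    have hex : ∃ i, σ i ≠ i := by
      by_contra h
      exact hσ (Equiv.ext fun i => Classical.not_not.1 fun hi => h ⟨i, hi⟩)
    obtain ⟨i, hi⟩ := hex
    have h0 : PiTensorProduct.map q (PiTensorProduct.tprod R fun k => j (σ k) (w (σ k))) = 0 := by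
      rw [PiTensorProduct.map_tprod]
      exact (PiTensorProduct.tprod R).map_coord_zero i (hqj' i (σ i) (Ne.symm hi) (w (σ i)))
    rw [Units.smul_def, map_zsmul, h0, zsmul_zero]
  · exact fun h => absurd (Finset.mem_univ _) h

/-- **Weil's map `Φ_j : M^{⊗m} → ⋀^m N` is injective** as soon as the `j_i` admit retractions `q_i` with `q_i j_k = 0` (`i ≠ k`):
`(⊗_i q_i) ∘ (antisymmetrisation) ∘ Φ_j = id`. [cite: Greub1978Multilinear, §5.3–§5.4] [cite: Milne1999LefschetzClasses, §3 p. 653] -/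
theorem lift_ιMulti_compLinearMap_injective (q : Fin m → (N →ₗ[R] M)) (hqj : ∀ i x, q i (j i x) = x)
    (hqj' : ∀ i k, i ≠ k → ∀ x, q i (j k x) = 0) :
    Function.Injective (PiTensorProduct.lift ((exteriorPower.ιMulti R m (M := N)).toMultilinearMap.compLinearMap j)) := by
  have h : (PiTensorProduct.map q ∘ₗ exteriorPower.toTensorPower R N m) ∘ₗ
      PiTensorProduct.lift ((exteriorPower.ιMulti R m (M := N)).toMultilinearMap.compLinearMap j) = LinearMap.id := by
    refine PiTensorProduct.ext (MultilinearMap.ext fun w => ?_)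
    rw [LinearMap.compMultilinearMap_apply, LinearMap.compMultilinearMap_apply, LinearMap.comp_apply, LinearMap.comp_apply,
      LinearMap.id_apply]
    exact map_toTensorPower_lift_ιMulti_compLinearMap_tprod j q hqj hqj' w
  intro x y hxy
  have hx := LinearMap.congr_fun h x
  have hy := LinearMap.congr_fun h y
  rw [LinearMap.comp_apply, LinearMap.id_apply] at hx hy
  rw [← hx, ← hy, hxy]

/-- **Equivariance of Weil's map**: if `G ∘ j_i = j_i ∘ g` for all `i`, then `⋀^m(G) (Φ_j z) = Φ_j (g^{⊗m} z)`.
[cite: Milne1999LefschetzClasses, §3 p. 653 (the action of `S(A)` on `H^*(A^r)`)] [cite: Moonen1999MTNotes, (1.13)] -/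
theorem exteriorPower_map_lift_ιMulti_compLinearMap {g : M →ₗ[R] M} {G : N →ₗ[R] N} (hG : ∀ i x, G (j i x) = j i (g x))
    (z : ⨂[R]^m M) :
    exteriorPower.map m G (PiTensorProduct.lift ((exteriorPower.ιMulti R m (M := N)).toMultilinearMap.compLinearMap j) z) =
      PiTensorProduct.lift ((exteriorPower.ιMulti R m (M := N)).toMultilinearMap.compLinearMap j)
        (PiTensorProduct.map (fun _ : Fin m => g) z) := by
  induction z using PiTensorProduct.induction_on with
  | smul_tprod r w =>
    simp only [map_smul, PiTensorProduct.map_tprod, lift_ιMulti_compLinearMap_tprod, exteriorPower.map_apply_ιMulti]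
    exact congrArg _ (congrArg _ (funext fun i => hG i (w i)))
  | add x y hx hy => rw [map_add, map_add, hx, hy, map_add, map_add]

end WeilLinearAlgebra

/-! ## §2 Weil's embedding `H^{⊗m} ↪ ⋀^m(H^{⊕m})` as a morphism of Hodge structures -/

section Weil

universe u

variable {V : Type u} [AddCommGroup V] [Module ℚ V] [HodgeTensorFacts.{u, u}] {n : ℤ} (H₀ : HodgeStructure V n) (m : ℕ)

/-- **Weil's morphism on pure tensors**: the composite of morphisms of Hodge structures `⊗_i in_i : H₀^{⊗m} → (H₀^{⊕m})^{⊗m}`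
(`Hom.tensorPowerMapFamily` of the coordinate inclusions `Hom.piSingle`) and `(H₀^{⊕m})^{⊗m} → ⋀^m(H₀^{⊕m})` (`Hom.tensorToWedge`)
sends `v₁ ⊗ ⋯ ⊗ v_m` to `in₁(v₁) ∧ ⋯ ∧ in_m(v_m)`. [cite: Milne1999LefschetzClasses, §3 p. 653] [cite: Weil1977HodgeRing, p. 424] -/
theorem weilHom_toLinearMap_tprod (v : Fin m → V) :
    ((Hom.tensorToWedge (HodgeStructure.pi fun _ : Fin m => H₀) m).comp
        (Hom.tensorPowerMapFamily fun i => Hom.piSingle (fun _ : Fin m => H₀) i)).toLinearMap (PiTensorProduct.tprod ℚ v) =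
      exteriorPower.ιMulti ℚ m (fun i => (Pi.single i (v i) : Fin m → V)) := by
  change (Hom.tensorToWedge (HodgeStructure.pi fun _ : Fin m => H₀) m).toLinearMap
      ((Hom.tensorPowerMapFamily fun i => Hom.piSingle (fun _ : Fin m => H₀) i).toLinearMap (PiTensorProduct.tprod ℚ v)) = _
  rw [Hom.tensorPowerMapFamily_toLinearMap, PiTensorProduct.map_tprod, Hom.tensorToWedge_toLinearMap, tensorToWedge_tprod]
  rfl

/-- **The linear map of Weil's morphism is `Φ_{in}`**, the `PiTensorProduct.lift` of `(v_i) ↦ ∧_i in_i(v_i)`.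
[cite: Milne1999LefschetzClasses, §3 p. 653] [cite: Weil1977HodgeRing, p. 424] -/
theorem weilHom_toLinearMap_eq :
    ((Hom.tensorToWedge (HodgeStructure.pi fun _ : Fin m => H₀) m).comp
        (Hom.tensorPowerMapFamily fun i => Hom.piSingle (fun _ : Fin m => H₀) i)).toLinearMap =
      PiTensorProduct.lift ((exteriorPower.ιMulti ℚ m (M := Fin m → V)).toMultilinearMap.compLinearMap
        fun i => LinearMap.single ℚ (fun _ : Fin m => V) i) := by
  refine PiTensorProduct.ext (MultilinearMap.ext fun v => ?_)
  rw [LinearMap.compMultilinearMap_apply, LinearMap.compMultilinearMap_apply, lift_ιMulti_compLinearMap_tprod,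
    weilHom_toLinearMap_tprod]
  rfl

/-- **Weil's embedding carries Hodge classes to Hodge classes**: `y ∈ Hdgᵖ(H₀^{⊗m}) ⟹ Φ y ∈ Hdgᵖ(⋀^m(H₀^{⊕m}))` (morphisms of
Hodge structures preserve Hodge classes, the tree's `Hom.map_hodgeClasses_le`; «the Hodge tensors of `T^{m,0}` become Hodge classes on
the power `A^m`»). [cite: Milne1999LefschetzClasses, §4 p. 660 («fixing all the Hodge classes on `A` and its powers»)] [cite: Weil1977HodgeRing, p. 424] -/
theorem lift_ιMulti_single_mem_hodgeClasses {p : ℤ} {y : ⨂[ℚ]^m V} (hy : y ∈ (H₀.tensorPower m).hodgeClasses p) :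
    PiTensorProduct.lift ((exteriorPower.ιMulti ℚ m (M := Fin m → V)).toMultilinearMap.compLinearMap
        fun i => LinearMap.single ℚ (fun _ : Fin m => V) i) y ∈
      ((HodgeStructure.pi fun _ : Fin m => H₀).exteriorPower m).hodgeClasses p := by
  rw [← weilHom_toLinearMap_eq H₀ m]
  exact Hom.map_hodgeClasses_le _ p ⟨y, hy, rfl⟩

omit [HodgeTensorFacts.{u, u}] in
/-- **Weil's embedding is injective** (retractions `pr_i`, `pr_i in_k = 0` for `i ≠ k`). [cite: Milne1999LefschetzClasses, §3 p. 653]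
[cite: Greub1978Multilinear, §5.3–§5.4] -/
theorem lift_ιMulti_single_injective :
    Function.Injective (PiTensorProduct.lift ((exteriorPower.ιMulti ℚ m (M := Fin m → V)).toMultilinearMap.compLinearMap
      fun i => LinearMap.single ℚ (fun _ : Fin m => V) i)) :=
  lift_ιMulti_compLinearMap_injective _ (fun i => LinearMap.proj i) (fun i x => by simp)
    (fun i k hik x => by simp [Pi.single_eq_of_ne hik])

end Weil

/-! ## §3 On `K`- and `ℂ`-points: `⋀^m(Δγ) Φ_K = Φ_K γ^{⊗m}`, `Φ_ℂ ι_⊗ = Θ Φ`, and the Hodge group through the powers -/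

section Points

universe uK u

variable (K : Type uK) [Field K] [Algebra ℚ K] {V : Type u} [AddCommGroup V] [Module ℚ V] (m : ℕ)

/-- **`⋀^m(Δγ) ∘ Φ_K = Φ_K ∘ γ^{⊗m}`** for Weil's map over `K` (`j_i = (in_i)_K`) and the DIAGONAL `Δγ` of `γ ∈ GL(K ⊗ V)`
(`Δγ ∘ (in_i)_K = (in_i)_K ∘ γ`, the tree's `piBlockDiag_comp_single_baseChange`), every field `K ⊇ ℚ`.
[cite: Milne1999LefschetzClasses, §3 p. 653] [cite: Moonen1999MTNotes, (1.13)] -/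
theorem exteriorPower_map_piDiagEmbedding_lift_ιMulti_single_baseChange (γ : (K ⊗[ℚ] V) ≃ₗ[K] (K ⊗[ℚ] V))
    (z : ⨂[K]^m (K ⊗[ℚ] V)) :
    exteriorPower.map m (piDiagEmbedding K V (Fin m) γ : (K ⊗[ℚ] (Fin m → V)) →ₗ[K] (K ⊗[ℚ] (Fin m → V)))
        (PiTensorProduct.lift ((exteriorPower.ιMulti K m (M := K ⊗[ℚ] (Fin m → V))).toMultilinearMap.compLinearMap
          fun i => (LinearMap.single ℚ (fun _ : Fin m => V) i).baseChange K) z) =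
      PiTensorProduct.lift ((exteriorPower.ιMulti K m (M := K ⊗[ℚ] (Fin m → V))).toMultilinearMap.compLinearMap
          fun i => (LinearMap.single ℚ (fun _ : Fin m => V) i).baseChange K) (tensorPowerCongr m γ z) := by
  change _ = PiTensorProduct.lift _ (PiTensorProduct.map (fun _ : Fin m => (γ : K ⊗[ℚ] V →ₗ[K] K ⊗[ℚ] V)) z)
  refine exteriorPower_map_lift_ιMulti_compLinearMap _ (fun i x => ?_) z
  rw [piDiagEmbedding_apply]
  exact LinearMap.congr_fun (piBlockDiag_comp_single_baseChange (W := fun _ : Fin m => V) (fun _ => γ) i) x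

/-- **Weil's map over `K` is injective** (retractions `(pr_i)_K`). [cite: Milne1999LefschetzClasses, §3 p. 653] [cite: Greub1978Multilinear, §5.3–§5.4] -/
theorem lift_ιMulti_single_baseChange_injective :
    Function.Injective (PiTensorProduct.lift ((exteriorPower.ιMulti K m (M := K ⊗[ℚ] (Fin m → V))).toMultilinearMap.compLinearMap
      fun i => (LinearMap.single ℚ (fun _ : Fin m => V) i).baseChange K)) := by
  refine lift_ιMulti_compLinearMap_injective _ (fun i => (LinearMap.proj i : (Fin m → V) →ₗ[ℚ] V).baseChange K)
    (fun i x => ?_) (fun i k hik x => ?_)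
  · rw [← LinearMap.comp_apply, ← LinearMap.baseChange_comp, LinearMap.proj_comp_single_same, LinearMap.baseChange_id,
      LinearMap.id_apply]
  · rw [← LinearMap.comp_apply, ← LinearMap.baseChange_comp, LinearMap.proj_comp_single_ne ℚ (fun _ : Fin m => V) i k hik,
      LinearMap.baseChange_zero, LinearMap.zero_apply]

omit [Algebra ℚ K] in
/-- **`γ^{⊗0} = id`** on `⨂^0` (the empty tensor power; the case `m = 0` of the criteria below is automatic). [folklore] -/
private theorem tensorPowerCongr_zero_apply {W : Type*} [AddCommGroup W] [Module K W] (γ : W ≃ₗ[K] W) (z : ⨂[K]^0 W) :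
    tensorPowerCongr 0 γ z = z := by
  have h : (tensorPowerCongr 0 γ : (⨂[K]^0 W) →ₗ[K] ⨂[K]^0 W) = LinearMap.id := by
    refine PiTensorProduct.ext (MultilinearMap.ext fun w => ?_)
    rw [LinearMap.compMultilinearMap_apply, LinearMap.compMultilinearMap_apply, coe_tensorPowerCongr,
      PiTensorProduct.map_tprod, LinearMap.id_apply]
    exact congrArg _ (funext fun i => Fin.elim0 i)
  rw [← LinearEquiv.coe_coe, h, LinearMap.id_apply]

variable [HodgeTensorFacts.{u, u}] {n : ℤ} (H₀ : HodgeStructure V n)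

omit [HodgeTensorFacts.{u, u}] in
/-- **`Φ_ℂ ∘ ι_⊗ = Θ ∘ Φ` in `⋀_ℂ(ℂ ⊗ V^{⊕m})`**: Weil's map over `ℂ` on the comparison `ι_⊗ y` of a rational tensor `y` is the
complexification `Θ = toComplexAlg` of the rational `m`-vector `Φ y` (both are `(1 ⊗ in₁v₁) ∧ ⋯ ∧ (1 ⊗ in_m v_m)` on `⊗ v`; as
`ℚ`-linear maps in `y`). [cite: BourbakiAlgebre1a3, Ch. III §7 no. 5 Prop. 8] [cite: Milne1999LefschetzClasses, §3 p. 653] -/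
theorem coe_lift_ιMulti_single_baseChange_piTensorToBaseChange (y : ⨂[ℚ]^m V) :
    ((PiTensorProduct.lift ((exteriorPower.ιMulti ℂ m (M := ℂ ⊗[ℚ] (Fin m → V))).toMultilinearMap.compLinearMap
          fun i => (LinearMap.single ℚ (fun _ : Fin m => V) i).baseChange ℂ) (piTensorToBaseChange ℂ V m y) :
        ⋀[ℂ]^m (ℂ ⊗[ℚ] (Fin m → V))) : ExteriorAlgebra ℂ (ℂ ⊗[ℚ] (Fin m → V))) =
      toComplexAlg (Fin m → V) ((PiTensorProduct.lift ((exteriorPower.ιMulti ℚ m (M := Fin m → V)).toMultilinearMap.compLinearMap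
          fun i => LinearMap.single ℚ (fun _ : Fin m => V) i) y : ⋀[ℚ]^m (Fin m → V)) : ExteriorAlgebra ℚ (Fin m → V)) := by
  -- both sides are `ℚ`-linear in `y`; compare on pure tensors
  let f₁ : (⨂[ℚ]^m V) →ₗ[ℚ] ExteriorAlgebra ℂ (ℂ ⊗[ℚ] (Fin m → V)) :=
    ((⋀[ℂ]^m (ℂ ⊗[ℚ] (Fin m → V))).subtype.restrictScalars ℚ) ∘ₗ
      ((PiTensorProduct.lift ((exteriorPower.ιMulti ℂ m (M := ℂ ⊗[ℚ] (Fin m → V))).toMultilinearMap.compLinearMap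
          fun i => (LinearMap.single ℚ (fun _ : Fin m => V) i).baseChange ℂ)).restrictScalars ℚ) ∘ₗ
        piTensorToBaseChange ℂ V m
  let f₂ : (⨂[ℚ]^m V) →ₗ[ℚ] ExteriorAlgebra ℂ (ℂ ⊗[ℚ] (Fin m → V)) :=
    (toComplexAlg (Fin m → V)).toLinearMap ∘ₗ (⋀[ℚ]^m (Fin m → V)).subtype ∘ₗ
      PiTensorProduct.lift ((exteriorPower.ιMulti ℚ m (M := Fin m → V)).toMultilinearMap.compLinearMap
        fun i => LinearMap.single ℚ (fun _ : Fin m => V) i)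
  have h : f₁ = f₂ := by
    refine PiTensorProduct.ext (MultilinearMap.ext fun v => ?_)
    simp only [f₁, f₂, LinearMap.compMultilinearMap_apply, LinearMap.comp_apply, LinearMap.restrictScalars_apply,
      Submodule.subtype_apply, AlgHom.toLinearMap_apply, piTensorToBaseChange_tprod, lift_ιMulti_compLinearMap_tprod,
      exteriorPower.ιMulti_apply_coe, toComplexAlg_ιMulti, LinearMap.baseChange_tmul]
  exact LinearMap.congr_fun h y

/-- **THE TRANSFER**: if the diagonal `⋀^m(Δγ)` fixes the complexification `Θ x` of every Hodge class `x ∈ Hdgᵖ(⋀^m(H₀^{⊕m}))`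
(`m ≥ 1`, `2p = mn`), then `γ^{⊗m}` fixes `ι_⊗ y` for every Hodge class `y ∈ Hdgᵖ(H₀^{⊗m})` — Weil's embedding turns Hodge tensors
of `T^{m,0}` into Hodge classes on the power, equivariantly and injectively. [cite: Milne1999LefschetzClasses, §4 p. 660 and proof of Prop. 4.8]
[cite: Weil1977HodgeRing, p. 424] [cite: GreenGriffithsKerr2012, §I.B (I.B.1), (I.B.3)] -/
theorem tensorPowerCongr_piTensorToBaseChange_eq_of_forall_piDiagEmbedding_map_toComplexAlg_eq
    (γ : (ℂ ⊗[ℚ] V) ≃ₗ[ℂ] (ℂ ⊗[ℚ] V)) {p : ℤ}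
    (hfix : ∀ x ∈ ((HodgeStructure.pi fun _ : Fin m => H₀).exteriorPower m).hodgeClasses p,
      ExteriorAlgebra.map (piDiagEmbedding ℂ V (Fin m) γ : (ℂ ⊗[ℚ] (Fin m → V)) →ₗ[ℂ] (ℂ ⊗[ℚ] (Fin m → V)))
        (toComplexAlg (Fin m → V) (x : ExteriorAlgebra ℚ (Fin m → V))) = toComplexAlg (Fin m → V) (x : ExteriorAlgebra ℚ (Fin m → V)))
    {y : ⨂[ℚ]^m V} (hy : y ∈ (H₀.tensorPower m).hodgeClasses p) :
    tensorPowerCongr m γ (piTensorToBaseChange ℂ V m y) = piTensorToBaseChange ℂ V m y := by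
  have hx := hfix _ (lift_ιMulti_single_mem_hodgeClasses H₀ m hy)
  rw [← coe_lift_ιMulti_single_baseChange_piTensorToBaseChange, ← coe_exteriorPower_map, Subtype.coe_inj,
    exteriorPower_map_piDiagEmbedding_lift_ιMulti_single_baseChange] at hx
  exact lift_ιMulti_single_baseChange_injective ℂ m hx

variable [Module.Finite ℚ V] {H₀} (Q₀ : Polarization H₀)

/-- **AN ISOMETRY OF `Q_ℂ` FIXING, THROUGH THE DIAGONAL, THE COMPLEXIFIED HODGE CLASSES OF ALL `⋀^m(H₀^{⊕m})` (`m ≥ 1`) LIES IN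
`Hg(H₀)(ℂ)`** — the transfer row by row and g39-#1 («`Hg(H)(K)` is cut out by the covariant Hodge tensors among the isometries»).
[cite: Milne1999LefschetzClasses, §4 p. 660 and Prop. 4.8 (proof)] [cite: GreenGriffithsKerr2012, §I.B p. 35 and (I.B.1)]
[cite: CarlsonMullerStachPeters2017, §15.2 Thm. 15.2.9 (ii)] -/
theorem Polarization.mem_hodgeGroupBaseChange_complex_of_forall_piDiagEmbedding_map_toComplexAlg_eq
    {γ : (ℂ ⊗[ℚ] V) ≃ₗ[ℂ] (ℂ ⊗[ℚ] V)} (hiso : ∀ x y, Q₀.form.baseChange ℂ (γ x) (γ y) = Q₀.form.baseChange ℂ x y)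
    (hfix : ∀ (m : ℕ), 0 < m → ∀ (p : ℤ), p + p = (m : ℤ) * n →
      ∀ x ∈ ((HodgeStructure.pi fun _ : Fin m => H₀).exteriorPower m).hodgeClasses p,
        ExteriorAlgebra.map (piDiagEmbedding ℂ V (Fin m) γ : (ℂ ⊗[ℚ] (Fin m → V)) →ₗ[ℂ] (ℂ ⊗[ℚ] (Fin m → V)))
          (toComplexAlg (Fin m → V) (x : ExteriorAlgebra ℚ (Fin m → V))) = toComplexAlg (Fin m → V) (x : ExteriorAlgebra ℚ (Fin m → V))) :
    γ ∈ H₀.hodgeGroupBaseChange ℂ := by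
  refine Q₀.mem_hodgeGroupBaseChange_of_forall_tensorPowerCongr_eq ℂ hiso fun m p hp y hy => ?_
  rcases Nat.eq_zero_or_pos m with rfl | hm
  · exact tensorPowerCongr_zero_apply ℂ γ _
  · exact tensorPowerCongr_piTensorToBaseChange_eq_of_forall_piDiagEmbedding_map_toComplexAlg_eq m H₀ γ (hfix m hm p hp) hy

/-- **MILNE'S `Hg′(A)` = DELIGNE'S HODGE GROUP, ON `ℂ`-POINTS**: for a polarized `ℚ`-Hodge structure `(H₀, Q₀)` and `γ ∈ GL(ℂ ⊗ V)`,
`γ ∈ Hg(H₀)(ℂ)` (the fixing group of ALL Hodge tensors `T^{a,b}`) iff `γ ∈ Aut(Q_ℂ)` and, for every `m ≥ 1` and every Hodge class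
`x ∈ Hdgᵖ(⋀^m(H₀^{⊕m}))` (`2p = mn`), the diagonal `⋀(Δγ)` fixes `Θ x` — «the largest algebraic subgroup … fixing all the Hodge
classes on `A` and its powers» with the character condition `(γ, 1)`, i.e. `γ` an isometry. `⟹`: `Hg(H₀)(ℂ) ⊂ Aut(Q_ℂ)` and
`Hg(H₀^{⊕m})(ℂ) = Δ Hg(H₀)(ℂ)` fixes the Hodge classes of `⋀^m` (p34's `mem_hodgeClasses_exteriorPower_pi_iff_forall_piDiagEmbedding_map_toComplexAlg_eq`).
[cite: Milne1999LefschetzClasses, §4 p. 660 and Prop. 4.8 (proof)] [cite: Deligne1982HodgeCycles, I §3 Prop. 3.4 and proof of Prop. 3.6]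
[cite: GreenGriffithsKerr2012, §I.B (I.B.1)] [cite: Moonen1999MTNotes, (1.13)] -/
theorem Polarization.mem_hodgeGroupBaseChange_complex_iff_forall_piDiagEmbedding_map_toComplexAlg_eq
    (γ : (ℂ ⊗[ℚ] V) ≃ₗ[ℂ] (ℂ ⊗[ℚ] V)) :
    γ ∈ H₀.hodgeGroupBaseChange ℂ ↔
      (∀ x y, Q₀.form.baseChange ℂ (γ x) (γ y) = Q₀.form.baseChange ℂ x y) ∧
        ∀ (m : ℕ), 0 < m → ∀ (p : ℤ), p + p = (m : ℤ) * n →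
          ∀ x ∈ ((HodgeStructure.pi fun _ : Fin m => H₀).exteriorPower m).hodgeClasses p,
            ExteriorAlgebra.map (piDiagEmbedding ℂ V (Fin m) γ : (ℂ ⊗[ℚ] (Fin m → V)) →ₗ[ℂ] (ℂ ⊗[ℚ] (Fin m → V)))
              (toComplexAlg (Fin m → V) (x : ExteriorAlgebra ℚ (Fin m → V))) =
                toComplexAlg (Fin m → V) (x : ExteriorAlgebra ℚ (Fin m → V)) := by
  refine ⟨fun hγ => ⟨Q₀.baseChange_form_apply_apply_of_mem_hodgeGroupBaseChange ℂ hγ, fun m hm p hp x hx => ?_⟩,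
    fun h => Q₀.mem_hodgeGroupBaseChange_complex_of_forall_piDiagEmbedding_map_toComplexAlg_eq h.1 h.2⟩
  haveI : Nonempty (Fin m) := ⟨⟨0, hm⟩⟩
  exact (mem_hodgeClasses_exteriorPower_pi_iff_forall_piDiagEmbedding_map_toComplexAlg_eq H₀ hp x).1 hx γ hγ

/-- **The same with Milne's quantifiers — ALL powers `A^r` (`r ≥ 1`, any finite non-empty index type) and ALL degrees `k`**:
`γ ∈ Hg(H₀)(ℂ)` iff `γ ∈ Aut(Q_ℂ)` and `⋀(Δγ)` fixes `Θ x` for every Hodge class `x ∈ Hdgᵖ(⋀^k(H₀^{⊕ι}))` (`2p = kn`), every finite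
non-empty `ι`, every `k` («`H^{2*}(A^r)(*)^{Hg(A)} = H(A^r)` for all `r`» read as the DEFINITION of `Hg′` on `ℂ`-points).
[cite: Milne1999LefschetzClasses, §4 p. 660 and Prop. 4.8 (proof)] [cite: Deligne1982HodgeCycles, I §3 Prop. 3.4] [cite: Moonen1999MTNotes, (1.13)] -/
theorem Polarization.mem_hodgeGroupBaseChange_complex_iff_forall_fintype (γ : (ℂ ⊗[ℚ] V) ≃ₗ[ℂ] (ℂ ⊗[ℚ] V)) :
    γ ∈ H₀.hodgeGroupBaseChange ℂ ↔
      (∀ x y, Q₀.form.baseChange ℂ (γ x) (γ y) = Q₀.form.baseChange ℂ x y) ∧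
        ∀ (ι : Type) [Fintype ι] [DecidableEq ι] [Nonempty ι] (k : ℕ) (p : ℤ), p + p = (k : ℤ) * n →
          ∀ x ∈ ((HodgeStructure.pi fun _ : ι => H₀).exteriorPower k).hodgeClasses p,
            ExteriorAlgebra.map (piDiagEmbedding ℂ V ι γ : (ℂ ⊗[ℚ] (ι → V)) →ₗ[ℂ] (ℂ ⊗[ℚ] (ι → V)))
              (toComplexAlg (ι → V) (x : ExteriorAlgebra ℚ (ι → V))) = toComplexAlg (ι → V) (x : ExteriorAlgebra ℚ (ι → V)) := by
  refine ⟨fun hγ => ⟨Q₀.baseChange_form_apply_apply_of_mem_hodgeGroupBaseChange ℂ hγ, fun ι _ _ _ k p hp x hx =>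
      (mem_hodgeClasses_exteriorPower_pi_iff_forall_piDiagEmbedding_map_toComplexAlg_eq H₀ hp x).1 hx γ hγ⟩,
    fun h => Q₀.mem_hodgeGroupBaseChange_complex_of_forall_piDiagEmbedding_map_toComplexAlg_eq h.1 fun m hm p hp x hx => ?_⟩
  haveI : Nonempty (Fin m) := ⟨⟨0, hm⟩⟩
  exact h.2 (Fin m) m p hp x hx

end Points

end HodgeStructure

end Literature.AlgebraicGeometry.Motives

end
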